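import Summits.AtomisticToContinuum.HydrodynamicLimit.Theses.TwoClocks

/-!
# Sketch — crux stmt-AtomisticToContinuum-16624 `TransferActivityTails`, round 2, ideator 4
# idea card `level-last-exponential-ui`: First-lemma signatures (typed, elaborating; nothing proved here)

* `SingleBallImpulseCap` — the few-body conjecture (isolated `N`-ball hard-sphere trajectories in `ℝ³`): the total impulse
  received by ONE ball over any time interval is at most `C` times the momentum spread `Σ_j ‖v_j − V_cm‖` at the start of
  the interval, `C` ABSOLUTE (independent of `N`, `ε`).  1-D sub-case proved on paper (monotone left-momentum functional,
  constant 2); rigorous 3-D rungs known: Serre 2021 (`Σ_balls ≤ c N² v̄`), moving-plane flux bound (this seat, `≤ 12(diam/ε)√(2N E_cm)`).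
* `ExpTransferActivityUI` — the LEVEL-FREE exponential-rate `L¹` tail of the crux's transfer activity under the TRUE pre-shock
  law (the card's replacement of the fixed-level tail in the clock; same frame as the crux up to `∀ t ∈ Ico 0 T`, then
  `∃ c C τ₀ ∀ M ∀ τ ≥ τ₀ ∃ N₀ ∀ N ∀ s`: `E[(N+1)⁻¹ Σ_i (a_i − M)₊] ≤ C e^{−cM}`; `τ₀` may depend on `t`).
* `EquilibriumExpTransferActivityUI` — its equilibrium rung (constant profiles, canonical Gibbs law).
-/

noncomputable section

open MeasureTheory Filter Set Topology
open scoped ENNReal InnerProductSpace BigOperators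

namespace Summit.AtomisticToContinuum.HydrodynamicLimit.Cruxes.TransferActivityTails.IdeatorFour

open Literature.MathematicalPhysics.KineticTheory Literature.Analysis.FluidPDE

/-- Euclidean configurations of `N` balls in `ℝ³`. -/
abbrev ECfg (N : ℕ) : Type := Config N (Fin 3) (EuclideanSpace ℝ (Fin 3))

/-- **Single-ball linear impulse cap (conjecture; the card's few-body input).**  There is an absolute constant `C` such
that for every `N`, every diameter `ε > 0`, every hard-sphere trajectory `γ` of `N` balls in `ℝ³` and every ball `i` and
times `a ≤ b`: the sum over the collisions of `i` with times in `(a, b]` of `‖v_i⁺ − v_i⁻‖` is at most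
`C · Σ_j ‖v_j(a) − V‖`, `V = N⁻¹ Σ_k v_k(a)` the centre-of-mass velocity.  (Energy and momentum are conserved, so the
right side controls all later spreads up to `√N`-Cauchy–Schwarz; the conjecture is that ONE ball cannot collect more than
`O(1)` times the total relative momentum — "each unit of relative momentum kicks a given ball `O(1)` times".) -/
def SingleBallImpulseCap : Prop :=
  ∃ C : ℝ, 0 < C ∧ ∀ (N : ℕ) (ε : ℝ), 0 < ε → ∀ γ : ℝ → ECfg N,
    IsHardSphereTrajectory (Euclidean.geometry (Fin 3)) ε N γ →
    ∀ (i : Fin N) (a b : ℝ), a ≤ b →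
      collisionSum (Euclidean.geometry (Fin 3)) ε γ (Set.Ioc a b)
          (fun c => if c.fst = i then ‖c.postVel.1 - c.preVel.1‖ else 0) ≤
        C * ∑ j : Fin N, ‖(γ a j).2 - (N : ℝ)⁻¹ • ∑ k : Fin N, (γ a k).2‖

/-- **Level-free exponential `L¹` tail of the window transfer activity under the true pre-shock law** (`C⁺` of the card:
what the level-last re-docked clock consumes in place of `TwoClocks.TransferActivityTails`).  Frame of the crux verbatim
up to `∀ t ∈ Ico 0 T`; then `∃ c > 0 ∃ C ∃ τ₀ > 0 ∀ M ≥ 0 ∀ τ ≥ τ₀ ∃ N₀ ∀ N ≥ N₀ ∀ s ∈ [0, t]`: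
`E_{λ₀}[(N+1)⁻¹ Σ_i (a_i(s) − M)₊] ≤ C·exp(−c·M)`, `a_i` the crux's transfer activity over `(s, s + w]`,
`w = τ (N+1)^{-1/3}`.  No level `V`, no `ε → 0` at fixed level: a uniform-integrability statement WITH an exponential rate. -/
def ExpTransferActivityUI : Prop :=
  ∀ (a₀ θ₀ : T3 → ℝ) (u₀ : T3 → V3), Continuous a₀ → Continuous θ₀ → Continuous u₀ →
    (∀ x, 0 < a₀ x) → (∀ x, 0 < θ₀ x) → ∃ σ₀ : ℝ, 0 < σ₀ ∧ ∀ σ : ℝ, 0 < σ → σ < σ₀ →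
    ∀ (T : ℝ) (ρ θ : ℝ → T3 → ℝ) (u : ℝ → T3 → V3), IsHardSphereEulerSolution σ T ρ u θ →
    ∀ Φ : (N : ℕ) → HardSphereFlow (Torus.geometry (Fin 3)) (hsDiameter σ N) (N + 1),
    TendstoHydroFieldsAt (fun N => localGibbsLaw σ a₀ u₀ θ₀ N (Φ N)) Φ ρ u θ 0 →
    ∀ t ∈ Set.Ico 0 T, ∃ c : ℝ, 0 < c ∧ ∃ C : ℝ, ∃ τ₀ : ℝ, 0 < τ₀ ∧ ∀ M : ℝ, 0 ≤ M →
    ∀ τ : ℝ, τ₀ ≤ τ → ∃ N₀ : ℕ, ∀ N : ℕ, N₀ ≤ N → ∀ s ∈ Set.Icc 0 t,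
      (let w : ℝ := τ * ((N : ℝ) + 1) ^ (-(1 / 3 : ℝ))
       let P := localGibbsLaw σ a₀ u₀ θ₀ N (Φ N)
       let act := fun (i : Fin (N + 1)) (z : Config (N + 1) (Fin 3) T3) =>
         σ / τ * (Φ N).collisionSum (Set.Ioc s (s + w))
           (fun c => if c.fst = i then ‖c.postVel.1 - c.preVel.1‖ + |‖c.postVel.1‖ ^ 2 - ‖c.preVel.1‖ ^ 2| / 2
             else 0) z
       ∫⁻ z, ENNReal.ofReal (((N : ℝ) + 1)⁻¹ * ∑ i : Fin (N + 1), max (act i z - M) 0) ∂P ≤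
         ENNReal.ofReal (C * Real.exp (-(c * M))))

/-- **Equilibrium rung of `ExpTransferActivityUI`** (constant profiles, canonical Gibbs law, window `(0, w]`): the
statement the card claims provable NOW modulo `SingleBallImpulseCap` (block convexity in the window — the landed
one-window / stationary-truncation shape — plus sub-Lanford one-block cluster statics). -/
def EquilibriumExpTransferActivityUI : Prop :=
  ∀ (a₀ θ₀ : ℝ) (u₀ : V3), 0 < a₀ → 0 < θ₀ → ∃ σ₀ : ℝ, 0 < σ₀ ∧ ∀ σ : ℝ, 0 < σ → σ < σ₀ →
    ∀ Φ : (N : ℕ) → HardSphereFlow (Torus.geometry (Fin 3)) (hsDiameter σ N) (N + 1),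
    ∃ c : ℝ, 0 < c ∧ ∃ C : ℝ, ∃ τ₀ : ℝ, 0 < τ₀ ∧ ∀ M : ℝ, 0 ≤ M →
    ∀ τ : ℝ, τ₀ ≤ τ → ∃ N₀ : ℕ, ∀ N : ℕ, N₀ ≤ N →
      (let w : ℝ := τ * ((N : ℝ) + 1) ^ (-(1 / 3 : ℝ))
       let P := localGibbsLaw σ (fun _ => a₀) (fun _ => u₀) (fun _ => θ₀) N (Φ N)
       let act := fun (i : Fin (N + 1)) (z : Config (N + 1) (Fin 3) T3) =>
         σ / τ * (Φ N).collisionSum (Set.Ioc 0 w)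
           (fun c => if c.fst = i then ‖c.postVel.1 - c.preVel.1‖ + |‖c.postVel.1‖ ^ 2 - ‖c.preVel.1‖ ^ 2| / 2
             else 0) z
       ∫⁻ z, ENNReal.ofReal (((N : ℝ) + 1)⁻¹ * ∑ i : Fin (N + 1), max (act i z - M) 0) ∂P ≤
         ENNReal.ofReal (C * Real.exp (-(c * M))))


/-! ## Architecture (C′): the CROWD-SPLIT / level-uniform-tilt re-dock (the card's recommendation for the MOMENTUM rows)

Records are split by an INSTANTANEOUS, level-free predicate — UNCROWDED: no third centre within `2ε_N` of the first
partner at the collision time — ON TOP of the activity clamp.  The crowded transfer (all of it, whatever its activity)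
is handed to a one-block REPLACEMENT LEMMA IN MEAN under the true law (`CrowdedStressReplacementWith`, level-free, no
tail, no rate); the uncrowded sub-clamp transfer is what the window LD must control, now at a tilt threshold UNIFORM in
the clamp level (`DoubleClampedMomentumTransferWindowLDWith`), so that the clamp level can be sent to infinity LAST with a
RATE-FREE remainder — no fixed-level tail statement, hence no tagged ergodic input (N1).  The two share the split
`Z = Zu + Zc` of the compressibility response through the parameter `Zu`.  Coefficient bookkeeping is indicative (it
copies crux 3's linear EOS projection); the tenure typing must match the clock's ledger (`OneWindowLedger`). -/

/-- **Double-clamped MOMENTUM-transfer window LD at global equilibrium, level-uniform tilt** (architecture (C′),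
momentum rows: what crux 3's momentum conjuncts become).  Crux 3's frame and momentum functional VERBATIM except:
(i) a record is retained iff it is UNCROWDED (`unc c z = 𝟙{no b ∉ {fst,snd} with euclidDist(x_b(t_c), x_fst(t_c)) ≤ 2ε_N}`)
AND both partners pass the transfer-activity clamp `ω = 𝟙{act ≤ V}`; (ii) the quantifier block is
`∃ β₀ ∃ V₀ ∀ V ≥ V₀ ∀ |β| ≤ β₀` — the tilt threshold is UNIFORM IN THE CLAMP LEVEL (the card's load-bearing claim:
with jammed droplets / cradles / cages crowded out, no flow-invariant or persistent Gibbs-priced structure has a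
sub-clamp mean momentum-row gain super-linear in its entropy cost; hot and boosted uncrowded blobs are booked by the
`‖v − u₀‖²` term of `Am`); (iii) `Z, Z'` are the UNCROWDED response `Zu(σ³), Zu'(σ³)`.  The energy row is
deliberately ABSENT: for it, hot boosted uncrowded blobs (invariant `(U, θ')`-Gibbs tilts) force `β₀(V) ≲ C V^{-1/3}`
under reference centring — the card's ENERGY-ROW DICHOTOMY. -/
def DoubleClampedMomentumTransferWindowLDWith (Zu : ℝ → ℝ) : Prop :=
  ∃ σ₀ : ℝ, 0 < σ₀ ∧ ∀ (a₀ θ₀ : ℝ) (u₀ : V3), 0 < a₀ → 0 < θ₀ → ∀ σ : ℝ, 0 < σ → σ < σ₀ →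
    ∀ Φ : (N : ℕ) → HardSphereFlow (Torus.geometry (Fin 3)) (hsDiameter σ N) (N + 1),
    ∀ φ : T3 → ℝ, Literature.Analysis.FunctionSpaces.Torus.IsSmooth φ →
    ∃ β₀ : ℝ, 0 < β₀ ∧ ∃ V₀ : ℝ, 0 < V₀ ∧ ∀ V : ℝ, V₀ ≤ V → ∀ β : ℝ, |β| ≤ β₀ → ∀ ε : ℝ, 0 < ε →
    ∃ τ₀ : ℝ, 0 < τ₀ ∧ ∀ τ : ℝ, τ₀ ≤ τ → ∃ N₀ : ℕ, ∀ N : ℕ, N₀ ≤ N →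
      (let w : ℝ := τ * ((N : ℝ) + 1) ^ (-(1 / 3 : ℝ))
       let P := localGibbsLaw σ (fun _ => a₀) (fun _ => u₀) (fun _ => θ₀) N (Φ N)
       let Z : ℝ := Zu (σ ^ 3)
       let Z' : ℝ := deriv Zu (σ ^ 3)
       let act := fun (i : Fin (N + 1)) (z : Config (N + 1) (Fin 3) T3) =>
         σ / τ * (Φ N).collisionSum (Set.Ioc 0 w)
           (fun c => if c.fst = i then ‖c.postVel.1 - c.preVel.1‖ + |‖c.postVel.1‖ ^ 2 - ‖c.preVel.1‖ ^ 2| / 2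
             else 0) z
       let ω := fun (i : Fin (N + 1)) (z : Config (N + 1) (Fin 3) T3) => if act i z ≤ V then (1 : ℝ) else 0
       let unc := fun (c : HardSphereCollisionRecord (Fin 3) T3 (N + 1)) (z : Config (N + 1) (Fin 3) T3) =>
         if (Finset.univ.filter fun b : Fin (N + 1) => b ≠ c.fst ∧ b ≠ c.snd ∧
               Torus.euclidDist (((Φ N).flow c.time z) b).1 c.fstPos ≤ 2 * hsDiameter σ N).card = 0
         then (1 : ℝ) else 0
       let Xm := fun (k : Fin 3) (z : Config (N + 1) (Fin 3) T3) =>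
         (Φ N).collisionSum (Set.Ioc 0 w)
           (fun c => unc c z * ω c.fst z * ω c.snd z *
             ((φ c.fstPos - φ c.sndPos) * (c.postVel.1 k - c.preVel.1 k)) / 2) z
       let Am := fun (k : Fin 3) (z : Config (N + 1) (Fin 3) T3) =>
         ∫ r in (0 : ℝ)..w, ∑ i, Literature.Analysis.FunctionSpaces.Torus.partialDeriv k φ ((Φ N).flow r z i).1 *
           (θ₀ * σ ^ 3 * Z' + (1 / 3) * (Z - 1) * ‖((Φ N).flow r z i).2 - u₀‖ ^ 2)
       ∀ k : Fin 3, ∫⁻ z, ENNReal.ofReal (Real.exp (β * (w⁻¹ * Xm k z - w⁻¹ * Am k z))) ∂P ≤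
           ENNReal.ofReal (Real.exp (ε * ((N : ℝ) + 1))))

/-- **Crowded-stress one-block replacement IN MEAN under the true pre-shock law** (architecture (C)'s crux-7 replacement;
crowded response `Zc := hsCompressibility − Zu`).  Frame of the crux verbatim up to `∀ t ∈ Ico 0 T`; then
`∀ φ smooth ∀ η > 0 ∃ τ₀ ∀ τ ≥ τ₀ ∃ N₀ ∀ N ∀ s ∈ [0, t]`: the window-averaged CROWDED momentum / energy transfer tested
against `φ` (records in `(s, s + w]` WITH a bystander within `2ε_N`), minus its linear equation-of-state projection onto
the empirical one-body fields with the crowded coefficients frozen at the Euler state `(ρ, u, θ)(s, x_i)`, is integrable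
and has `λ₀`-mean of modulus `≤ η (N + 1)`.  No level `V`, no tail, no rate: the classical shape of a replacement lemma. -/
def CrowdedStressReplacementWith (Zu : ℝ → ℝ) : Prop :=
  ∀ (a₀ θ₀ : T3 → ℝ) (u₀ : T3 → V3), Continuous a₀ → Continuous θ₀ → Continuous u₀ →
    (∀ x, 0 < a₀ x) → (∀ x, 0 < θ₀ x) → ∃ σ₀ : ℝ, 0 < σ₀ ∧ ∀ σ : ℝ, 0 < σ → σ < σ₀ →
    ∀ (T : ℝ) (ρ θ : ℝ → T3 → ℝ) (u : ℝ → T3 → V3), IsHardSphereEulerSolution σ T ρ u θ →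
    ∀ Φ : (N : ℕ) → HardSphereFlow (Torus.geometry (Fin 3)) (hsDiameter σ N) (N + 1),
    TendstoHydroFieldsAt (fun N => localGibbsLaw σ a₀ u₀ θ₀ N (Φ N)) Φ ρ u θ 0 →
    ∀ t ∈ Set.Ico 0 T, ∀ φ : T3 → ℝ, Literature.Analysis.FunctionSpaces.Torus.IsSmooth φ →
    ∀ η : ℝ, 0 < η → ∃ τ₀ : ℝ, 0 < τ₀ ∧ ∀ τ : ℝ, τ₀ ≤ τ → ∃ N₀ : ℕ, ∀ N : ℕ, N₀ ≤ N → ∀ s ∈ Set.Icc 0 t,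
      (let w : ℝ := τ * ((N : ℝ) + 1) ^ (-(1 / 3 : ℝ))
       let P := localGibbsLaw σ a₀ u₀ θ₀ N (Φ N)
       let Zc : ℝ → ℝ := fun η' => hsCompressibility η' - Zu η'
       let cr := fun (c : HardSphereCollisionRecord (Fin 3) T3 (N + 1)) (z : Config (N + 1) (Fin 3) T3) =>
         if (Finset.univ.filter fun b : Fin (N + 1) => b ≠ c.fst ∧ b ≠ c.snd ∧
               Torus.euclidDist (((Φ N).flow c.time z) b).1 c.fstPos ≤ 2 * hsDiameter σ N).card = 0
         then (0 : ℝ) else 1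
       let Xm := fun (k : Fin 3) (z : Config (N + 1) (Fin 3) T3) =>
         (Φ N).collisionSum (Set.Ioc s (s + w))
           (fun c => cr c z * ((φ c.fstPos - φ c.sndPos) * (c.postVel.1 k - c.preVel.1 k)) / 2) z
       let Am := fun (k : Fin 3) (z : Config (N + 1) (Fin 3) T3) =>
         ∫ r in s..(s + w), ∑ i, Literature.Analysis.FunctionSpaces.Torus.partialDeriv k φ ((Φ N).flow r z i).1 *
           (θ s ((Φ N).flow r z i).1 * (ρ s ((Φ N).flow r z i).1 * σ ^ 3) *
               deriv Zc (ρ s ((Φ N).flow r z i).1 * σ ^ 3) +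
             (1 / 3) * (Zc (ρ s ((Φ N).flow r z i).1 * σ ^ 3) - 1) *
               ‖((Φ N).flow r z i).2 - u s ((Φ N).flow r z i).1‖ ^ 2)
       let Xe := fun (z : Config (N + 1) (Fin 3) T3) =>
         (Φ N).collisionSum (Set.Ioc s (s + w))
           (fun c => cr c z * ((φ c.fstPos - φ c.sndPos) * ((‖c.postVel.1‖ ^ 2 - ‖c.preVel.1‖ ^ 2) / 2)) / 2) z
       let Ae := fun (z : Config (N + 1) (Fin 3) T3) =>
         ∫ r in s..(s + w), ∑ i,
           ((∑ l, u s ((Φ N).flow r z i).1 l *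
                 Literature.Analysis.FunctionSpaces.Torus.partialDeriv l φ ((Φ N).flow r z i).1) *
               (θ s ((Φ N).flow r z i).1 * (ρ s ((Φ N).flow r z i).1 * σ ^ 3) *
                   deriv Zc (ρ s ((Φ N).flow r z i).1 * σ ^ 3) +
                 (1 / 3) * (Zc (ρ s ((Φ N).flow r z i).1 * σ ^ 3) - 1) *
                   ‖((Φ N).flow r z i).2 - u s ((Φ N).flow r z i).1‖ ^ 2) +
             θ s ((Φ N).flow r z i).1 * (Zc (ρ s ((Φ N).flow r z i).1 * σ ^ 3) - 1) *
               (∑ l, Literature.Analysis.FunctionSpaces.Torus.partialDeriv l φ ((Φ N).flow r z i).1 *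
                 (((Φ N).flow r z i).2 - u s ((Φ N).flow r z i).1) l))
       (∀ k : Fin 3, Integrable (fun z => w⁻¹ * Xm k z - w⁻¹ * Am k z) P ∧
           |∫ z, (w⁻¹ * Xm k z - w⁻¹ * Am k z) ∂P| ≤ η * ((N : ℝ) + 1)) ∧
         (Integrable (fun z => w⁻¹ * Xe z - w⁻¹ * Ae z) P ∧
           |∫ z, (w⁻¹ * Xe z - w⁻¹ * Ae z) ∂P| ≤ η * ((N : ℝ) + 1)))

/-- Sanity: the hinge dominates the fixed-level tail pointwise — `y·𝟙{V < y} ≤ 2·(y − V/2)₊` for `0 ≤ y`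
(the one-line algebra by which a level-free UI bound prices the clock's clamp remainder at level `V`). -/
theorem tail_le_two_mul_hinge (V y : ℝ) :
    Set.indicator {z : ℝ | V < z} (fun z => z) y ≤ 2 * max (y - V / 2) 0 := by
  by_cases h : V < y
  · rw [Set.indicator_of_mem (show y ∈ {z : ℝ | V < z} from h)]
    have : y ≤ 2 * (y - V / 2) := by linarith
    exact this.trans (by gcongr; exact le_max_left _ _)
  · rw [Set.indicator_of_notMem (show y ∉ {z : ℝ | V < z} from h)]
    positivity

end Summit.AtomisticToContinuum.HydrodynamicLimit.Cruxes.TransferActivityTails.IdeatorFour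

end
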